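import Summits.CriticalPhenomena.PercolationContinuityZ3.Theorems.SahiMasterFamilyKahnModulePrelim

/-!
# Kahn's third-order inequality is preserved under MODULE EXTENSIONS
# (lineage `prim-master-conj`, gen 55; `--supports stmt-CriticalPhenomena-4575`)

Support file (crux `NoHeavyLowerTail`, stmt-CriticalPhenomena-4575).  Nothing here asserts Kahn's Conjecture 5 [Kahn 2022] /
Sahi's `C₃` [Sahi 2008, Conj. 5]; we prove that the class of pairs `(B,C)` satisfying Kahn's inequality
`E₃(1_A,1_B,1_C) ≥ 0` FOR ALL increasing `A` is closed under attaching a fresh independent module.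

Setting of `…SahiMasterFamilyKahnModulePrelim`: `X` (the old space) and `Y` (the fresh module) are finite preorders with
probability weights `w, w'` satisfying Harris' inequality; `g, h : X → ℝ` are monotone indicators (`1_B, 1_C`), `v : Y → ℝ`
a monotone indicator (`1_V`); on `X × Y` with the product weight, `g̃ = liftX g`, `ṽ = liftY v`, `B ∧ V ↦ g̃·ṽ`,
`B ∨ V ↦ bor g v = g̃ + ṽ − g̃ṽ`.  Hypothesis throughout: `KahnPair w g h` (Kahn's inequality for `(B,C)` on `X` against
every monotone `f ≥ 0`).  Conclusions (Kahn's inequality on `X × Y` against every monotone `F ≥ 0`):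

* `kahnPair_and_left`  : `(B ∧ V, C)`  — `E₃ ≥ b·Cov_Y(v, H) + κ·Cov_Y(v, a) ≥ 0`
  (`H(y) = E_X[F(·,y) h]`, `a(y) = E_X F(·,y)`, `κ = Cov_X(g,h)`);
* `kahnPair_and_and`   : `(B ∧ V, C ∧ V)` — `E₃ ≥ v̄(1−v̄)·b·c·E F ≥ 0`;
* `kahnPair_or_left`   : `(B ∨ V, C)`  — from the two fibre identities
  `v̄ψ_on − θ = v̄(1−(1−v̄)b)(h − c) + v̄(1−v̄)(gh − d)` and `(1−v̄)ψ_off + θ = (1−v̄)²ψ_{BC} + v̄(1−v̄)(gh − c g)` with the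
  vertical transfer `θ = v̄(1−v̄)h(1−g)`, giving `v̄(1−v̄)E₃ ≥ Cov_Y(v, Θ) ≥ 0`;
* `kahnPair_or_or`     : `(B ∨ V, C ∨ V)` — from the pointwise domination `S·[(1−v̄)ψ_off + v̄s] ≥ s·ψ_{BC}`
  (`S = 2−b−c−κ`, `s` the constant value of `ψ` on `V`), giving `(1−v̄)S·E₃ ≥ s·S·Cov_Y(v, a) ≥ 0`;
* `(B ∧ V, C ∨ V)` is NESTED (`g̃ṽ ≤ bor h v`) — `kahnPair_and_or` via `kahnPair_of_le`.

Together with `kahnPair_liftX` (dummy module), `KahnPair.symm`, `isHarris_prodW`, `isHarris_bool` and the trivial pairs, this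
proves Kahn's Conjecture 5 for every triple `(A,B,C)` of increasing events of a product of two-point (indeed: Harris) spaces in
which `A` is arbitrary and `(B,C)` is *jointly module-peelable*: reducible to a trivial pair by repeatedly splitting off a
module of fresh coordinates that enters each of `B`, `C` as a top conjunct, a top disjunct, or not at all (e.g. both read-once
along a common modular decomposition: `(x₁x₂ ∨ x₃x₄, (x₁ ∨ x₂)x₅)`).  The certificates were found by the lineage's
cell-transfer LP (gen 54/55) and are verified here symbolically.  [this work]
-/

open Finset
open scoped BigOperators

namespace Summit.CriticalPhenomena.PercolationContinuityZ3.Theorems.SahiKahnModule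

variable {X Y : Type*} [Fintype X] [Fintype Y] [Preorder X] [Preorder Y]

/-! ## Fibre bookkeeping on `X × Y` -/

section Fibre
variable (w : X → ℝ) (w' : Y → ℝ) (F : X × Y → ℝ) (g h : X → ℝ) (v : Y → ℝ)

omit [Preorder X] [Preorder Y] in
/-- `E(F·g̃ṽ·h̃) = E_Y(v · E_X(F_y g h))`. [this work] -/
theorem ex_F_gv_h : ex (prodW w w') (F * (liftX g * liftY v) * liftX h) =
    ex w' (fun y => v y * ex w ((fun x => F (x, y)) * g * h)) := by
  rw [ex_prodW]; refine congrArg _ (funext fun y => ?_)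
  unfold ex; rw [mul_sum]; exact sum_congr rfl fun x _ => by simp only [Pi.mul_apply, liftX, liftY]; ring

omit [Preorder X] [Preorder Y] in
/-- `E(F·g̃ṽ) = E_Y(v · E_X(F_y g))`. [this work] -/
theorem ex_F_gv : ex (prodW w w') (F * (liftX g * liftY v)) = ex w' (fun y => v y * ex w ((fun x => F (x, y)) * g)) := by
  rw [ex_prodW]; refine congrArg _ (funext fun y => ?_)
  unfold ex; rw [mul_sum]; exact sum_congr rfl fun x _ => by simp only [Pi.mul_apply, liftX, liftY]; ring

omit [Preorder X] [Preorder Y] in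
/-- `E(F·g̃) = E_Y(E_X(F_y g))`. [this work] -/
theorem ex_F_g : ex (prodW w w') (F * liftX g) = ex w' (fun y => ex w ((fun x => F (x, y)) * g)) := by
  rw [ex_prodW]; rfl

omit [Preorder X] [Preorder Y] in
/-- `E(g̃ṽ) = E_Y v · E_X g`. [this work] -/
theorem ex_gv : ex (prodW w w') (liftX g * liftY v) = ex w' v * ex w g := by
  rw [ex_prodW]
  have : (fun y => ex w fun x => (liftX g * liftY v : X × Y → ℝ) (x, y)) = fun y => ex w g * v y := by
    funext y; unfold ex; rw [sum_mul]; exact sum_congr rfl fun x _ => by simp only [Pi.mul_apply, liftX, liftY]; ring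
  rw [this, ex_smul]; ring

omit [Preorder X] [Preorder Y] in
/-- `E(g̃ṽ·h̃) = E_Y v · E_X(g h)`. [this work] -/
theorem ex_gv_h : ex (prodW w w') (liftX g * liftY v * liftX h) = ex w' v * ex w (g * h) := by
  rw [ex_prodW]
  have : (fun y => ex w fun x => (liftX g * liftY v * liftX h : X × Y → ℝ) (x, y)) = fun y => ex w (g * h) * v y := by
    funext y; unfold ex; rw [sum_mul]; exact sum_congr rfl fun x _ => by simp only [Pi.mul_apply, liftX, liftY]; ring
  rw [this, ex_smul]; ring

omit [Preorder X] [Preorder Y] in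
/-- `E(g̃) = E_X g` (probability weight on `Y`). [this work] -/
theorem ex_liftX (hw' : IsProbWeight w') : ex (prodW w w') (liftX g) = ex w g := by
  rw [ex_prodW]; exact ex_const hw' (ex w g)

end Fibre

/-! ## `B ∧ V` against `C`: `kahnPair_and_left` -/

omit [Fintype X] [Preorder X] [Preorder Y] in
/-- Linearity bookkeeping for `kahnPair_and_left`. [this work] -/
theorem ex_lin_and_left (w' : Y → ℝ) (v D G H a : Y → ℝ) (b c d : ℝ) :
    ex w' (fun y => v y * (2 * D y - G y * c - H y * b - d * a y + a y * b * c)) =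
      2 * ex w' (fun y => v y * D y) - ex w' (fun y => v y * G y) * c - ex w' (fun y => v y * H y) * b
        - d * ex w' (fun y => v y * a y) + ex w' (fun y => v y * a y) * b * c := by
  simp only [ex, mul_sum, sum_mul, ← sum_sub_distrib, ← sum_add_distrib]
  exact sum_congr rfl fun y _ => by ring

/-- **Module extension `(B,C) ↦ (B ∧ V, C)`.**  If `(g,h)` is a Kahn pair on the Harris space `X` and `v` is a monotone
nonnegative function on the Harris space `Y`, then `(g̃·ṽ, h̃)` is a Kahn pair on `X × Y`:
`E₃(F, g̃ṽ, h̃) ≥ b·Cov_Y(v,H) + κ·Cov_Y(v,a) ≥ 0`. [this work] -/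
theorem kahnPair_and_left {w : X → ℝ} {w' : Y → ℝ} (hw : IsProbWeight w) (hw' : IsProbWeight w') (hX : IsHarris w)
    (hY : IsHarris w') {g h : X → ℝ} {v : Y → ℝ} (hg : IsIndicator g) (hh : IsIndicator h) (hgm : Monotone g)
    (hhm : Monotone h) (hvm : Monotone v) (hv0 : ∀ y, 0 ≤ v y) (hK : KahnPair w g h) :
    KahnPair (prodW w w') (liftX g * liftY v) (liftX h) := by
  intro F hF hF0
  -- fibre quantities
  set a : Y → ℝ := fun y => ex w (fun x => F (x, y)) with ha
  set D : Y → ℝ := fun y => ex w ((fun x => F (x, y)) * g * h) with hD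
  set G : Y → ℝ := fun y => ex w ((fun x => F (x, y)) * g) with hG
  set H : Y → ℝ := fun y => ex w ((fun x => F (x, y)) * h) with hH
  have hb := ex_indicator_mem hw hg
  have hκ : ex w g * ex w h ≤ ex w (g * h) := hX g h hgm hhm
  -- the functional, fibrewise
  have e1 := ex_F_gv_h w w' F g h v
  have e2 := ex_F_gv w w' F g v
  have e3 := ex_F_g w w' F h
  have e4 := ex_gv w w' g v
  have e5 := ex_gv_h w w' g h v
  have e6 := ex_liftX w w' h hw'
  have e7 : ex (prodW w w') F = ex w' a := ex_prodW _ _ _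
  -- fibrewise Kahn (times v ≥ 0) and the two Harris covariances on Y
  have ih : ex w' (fun y => v y * (2 * D y - G y * ex w h - H y * ex w g - ex w (g * h) * a y + a y * ex w g * ex w h))
      ≥ 0 := ex_nonneg hw'.nonneg fun y => mul_nonneg (hv0 y) (hK _ (monotone_fibre_left hF y) fun x => hF0 (x, y))
  rw [ex_lin_and_left] at ih
  have Hm : Monotone H := monotone_ex_fibre hw.nonneg (F := F * liftX h)
    (hF.mul (monotone_liftX hhm) hF0 fun z => hh.nonneg z.1)
  have am : Monotone a := monotone_ex_fibre hw.nonneg hF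
  have cH := hY.ex_mul_sub_nonneg Hm hvm
  have ca := hY.ex_mul_sub_nonneg am hvm
  have lH : ex w' (fun y => H y * (v y - ex w' v)) = ex w' (fun y => v y * H y) - ex w' H * ex w' v := by
    rw [show (fun y => H y * (v y - ex w' v)) = (fun y => v y * H y) - fun y => ex w' v * H y from by
      funext y; simp only [Pi.sub_apply]; ring, ex_sub, ex_smul]; ring
  have la : ex w' (fun y => a y * (v y - ex w' v)) = ex w' (fun y => v y * a y) - ex w' a * ex w' v := by
    rw [show (fun y => a y * (v y - ex w' v)) = (fun y => v y * a y) - fun y => ex w' v * a y from by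
      funext y; simp only [Pi.sub_apply]; ring, ex_sub, ex_smul]; ring
  rw [lH] at cH; rw [la] at ca
  unfold kahnK
  rw [e1, e2, e3, e4, e5, e6, e7]
  nlinarith [mul_nonneg hb.1 cH, mul_nonneg (sub_nonneg.2 hκ) ca]


/-! ## `B ∧ V` against `C ∧ V`: `kahnPair_and_and` -/

omit [Preorder X] [Preorder Y] in
/-- `E(F·g̃ṽ·h̃ṽ) = E_Y(v · E_X(F_y g h))` for an indicator `v`. [this work] -/
theorem ex_F_gv_hv (w : X → ℝ) (w' : Y → ℝ) (F : X × Y → ℝ) (g h : X → ℝ) {v : Y → ℝ} (hv : IsIndicator v) :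
    ex (prodW w w') (F * (liftX g * liftY v) * (liftX h * liftY v)) =
      ex w' (fun y => v y * ex w ((fun x => F (x, y)) * g * h)) := by
  rw [ex_prodW]; refine congrArg _ (funext fun y => ?_)
  unfold ex; rw [mul_sum]
  exact sum_congr rfl fun x _ => by
    simp only [Pi.mul_apply, liftX, liftY]; linear_combination (w x * F (x, y) * g x * h x) * hv.mul_self y

omit [Preorder X] [Preorder Y] in
/-- `E(g̃ṽ·h̃ṽ) = E_Y v · E_X(g h)` for an indicator `v`. [this work] -/
theorem ex_gv_hv (w : X → ℝ) (w' : Y → ℝ) (g h : X → ℝ) {v : Y → ℝ} (hv : IsIndicator v) :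
    ex (prodW w w') (liftX g * liftY v * (liftX h * liftY v)) = ex w' v * ex w (g * h) := by
  rw [ex_prodW]
  have : (fun y => ex w fun x => (liftX g * liftY v * (liftX h * liftY v) : X × Y → ℝ) (x, y)) =
      fun y => ex w (g * h) * v y := by
    funext y; unfold ex; rw [sum_mul]
    exact sum_congr rfl fun x _ => by
      simp only [Pi.mul_apply, liftX, liftY]; linear_combination (w x * g x * h x) * hv.mul_self y
  rw [this, ex_smul]; ring

omit [Fintype X] [Preorder X] [Preorder Y] in
/-- Linearity bookkeeping: `E_Y(v·(Z − b·a)) = E_Y(vZ) − b·E_Y(va)`. [this work] -/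
theorem ex_lin_sub (w' : Y → ℝ) (v Z a : Y → ℝ) (b : ℝ) :
    ex w' (fun y => v y * (Z y - b * a y)) = ex w' (fun y => v y * Z y) - b * ex w' (fun y => v y * a y) := by
  simp only [ex, mul_sum, ← sum_sub_distrib]
  exact sum_congr rfl fun y _ => by ring

/-- **Module extension `(B,C) ↦ (B ∧ V, C ∧ V)`.**  If `(g,h)` is a Kahn pair on the Harris space `X` and `v` a monotone
indicator on the Harris space `Y`, then `(g̃ṽ, h̃ṽ)` is a Kahn pair on `X × Y`; quantitatively
`E₃(F, g̃ṽ, h̃ṽ) ≥ v̄(1−v̄)·b·c·E F`. [this work] -/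
theorem kahnPair_and_and {w : X → ℝ} {w' : Y → ℝ} (hw : IsProbWeight w) (hw' : IsProbWeight w') (hX : IsHarris w)
    (hY : IsHarris w') {g h : X → ℝ} {v : Y → ℝ} (hg : IsIndicator g) (hh : IsIndicator h) (hgm : Monotone g)
    (hhm : Monotone h) (hv : IsIndicator v) (hvm : Monotone v) (hK : KahnPair w g h) :
    KahnPair (prodW w w') (liftX g * liftY v) (liftX h * liftY v) := by
  intro F hF hF0
  set a : Y → ℝ := fun y => ex w (fun x => F (x, y)) with ha
  set D : Y → ℝ := fun y => ex w ((fun x => F (x, y)) * g * h) with hD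
  set G : Y → ℝ := fun y => ex w ((fun x => F (x, y)) * g) with hG
  set H : Y → ℝ := fun y => ex w ((fun x => F (x, y)) * h) with hH
  have hb := ex_indicator_mem hw hg
  have hc := ex_indicator_mem hw hh
  have hvb := ex_indicator_mem hw' hv
  have hκ : ex w g * ex w h ≤ ex w (g * h) := hX g h hgm hhm
  have hA : 0 ≤ ex w' a := ex_nonneg hw'.nonneg fun y => ex_nonneg hw.nonneg fun x => hF0 (x, y)
  have e1 := ex_F_gv_hv w w' F g h hv
  have e2 := ex_F_gv w w' F g v
  have e3 := ex_F_gv w w' F h v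
  have e4 := ex_gv w w' g v
  have e5 := ex_gv w w' h v
  have e6 := ex_gv_hv w w' g h hv
  have e7 : ex (prodW w w') F = ex w' a := ex_prodW _ _ _
  -- fibrewise Kahn (times v ≥ 0)
  have ih : ex w' (fun y => v y * (2 * D y - G y * ex w h - H y * ex w g - ex w (g * h) * a y + a y * ex w g * ex w h))
      ≥ 0 := ex_nonneg hw'.nonneg fun y => mul_nonneg (hv.nonneg y) (hK _ (monotone_fibre_left hF y) fun x => hF0 (x, y))
  rw [ex_lin_and_left] at ih
  -- fibrewise Harris on X: G ≥ b·a, H ≥ c·a (times v ≥ 0)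
  have iG : ex w' (fun y => v y * (G y - ex w g * a y)) ≥ 0 := ex_nonneg hw'.nonneg fun y =>
    mul_nonneg (hv.nonneg y) (by
      have := hX _ g (monotone_fibre_left hF y) hgm; simp only [hG, ha]; linarith)
  have iH : ex w' (fun y => v y * (H y - ex w h * a y)) ≥ 0 := ex_nonneg hw'.nonneg fun y =>
    mul_nonneg (hv.nonneg y) (by
      have := hX _ h (monotone_fibre_left hF y) hhm; simp only [hH, ha]; linarith)
  rw [ex_lin_sub] at iG iH
  -- Harris on Y for (v, a)
  have am : Monotone a := monotone_ex_fibre hw.nonneg hF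
  have ca := hY.ex_mul_sub_nonneg am hvm
  have la : ex w' (fun y => a y * (v y - ex w' v)) = ex w' (fun y => v y * a y) - ex w' a * ex w' v := by
    rw [show (fun y => a y * (v y - ex w' v)) = (fun y => v y * a y) - fun y => ex w' v * a y from by
      funext y; simp only [Pi.sub_apply]; ring, ex_sub, ex_smul]; ring
  rw [la] at ca
  unfold kahnK
  rw [e1, e2, e3, e4, e5, e6, e7]
  have h1 := mul_nonneg (mul_nonneg (sub_nonneg.2 hvb.2) hc.1) iG
  have h2 := mul_nonneg (mul_nonneg (sub_nonneg.2 hvb.2) hb.1) iH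
  have h3 := mul_nonneg (sub_nonneg.2 hκ) ca
  have h4 := mul_nonneg (mul_nonneg (mul_nonneg hb.1 hc.1) (sub_nonneg.2 hvb.2)) ca
  have h5 := mul_nonneg (mul_nonneg (mul_nonneg (mul_nonneg hb.1 hc.1) (sub_nonneg.2 hvb.2)) hvb.1) hA
  linear_combination ih + h1 + h2 + h3 + 2 * h4 + h5

/-! ## `B ∨ V`: the disjunction with a fresh module -/

/-- `B ∨ V` on `X × Y` for indicators: `bor g v (x,y) = g x + v y − g x · v y`. [this work] -/
def bor (g : X → ℝ) (v : Y → ℝ) : X × Y → ℝ := fun z => g z.1 + v z.2 - g z.1 * v z.2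

omit [Fintype X] [Fintype Y] [Preorder X] [Preorder Y] in
/-- `bor` of indicators is an indicator. [this work] -/
theorem isIndicator_bor {g : X → ℝ} {v : Y → ℝ} (hg : IsIndicator g) (hv : IsIndicator v) : IsIndicator (bor g v) :=
  fun z => by unfold bor; rcases hg z.1 with a | a <;> rcases hv z.2 with b | b <;> simp [a, b]

omit [Fintype X] [Fintype Y] in
/-- `bor` of monotone indicators is monotone (`bor = 1 − (1−g̃)(1−ṽ)`). [this work] -/
theorem monotone_bor {g : X → ℝ} {v : Y → ℝ} (hg : IsIndicator g) (hv : IsIndicator v) (hgm : Monotone g)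
    (hvm : Monotone v) : Monotone (bor g v) := by
  intro z z' hzz'
  have h1 : g z.1 ≤ g z'.1 := hgm (Prod.mk_le_mk.1 hzz').1
  have h2 : v z.2 ≤ v z'.2 := hvm (Prod.mk_le_mk.1 hzz').2
  unfold bor
  nlinarith [hg.le_one z'.1, hv.nonneg z.2, hv.le_one z'.2, hg.nonneg z.1, mul_nonneg (sub_nonneg.2 h1) (sub_nonneg.2 (hv.le_one z.2)),
    mul_nonneg (sub_nonneg.2 (hg.le_one z'.1)) (sub_nonneg.2 h2)]

omit [Fintype X] [Fintype Y] [Preorder X] [Preorder Y] in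
/-- `g̃·ṽ ≤ bor h v` pointwise for indicators (`B ∧ V ⊆ V ⊆ C ∨ V`). [this work] -/
theorem liftX_mul_liftY_le_bor {g h : X → ℝ} {v : Y → ℝ} (hg : IsIndicator g) (hh : IsIndicator h)
    (hv : IsIndicator v) (z : X × Y) : (liftX g * liftY v : X × Y → ℝ) z ≤ bor h v z := by
  simp only [Pi.mul_apply, liftX, liftY, bor]
  nlinarith [hg.le_one z.1, hv.nonneg z.2, hh.nonneg z.1, hv.le_one z.2, mul_nonneg (hh.nonneg z.1) (sub_nonneg.2 (hv.le_one z.2)),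
    mul_nonneg (sub_nonneg.2 (hg.le_one z.1)) (hv.nonneg z.2)]

/-- **Module extension `(B,C) ↦ (B ∧ V, C ∨ V)`** needs no hypothesis on `(g,h)`: the pair is nested
(`g̃ṽ ≤ bor h v`), so Kahn's inequality holds on the Harris space `X × Y` by `kahnPair_of_le`. [this work] -/
theorem kahnPair_and_or {w : X → ℝ} {w' : Y → ℝ} (hw : IsProbWeight w) (hw' : IsProbWeight w') (hX : IsHarris w)
    (hY : IsHarris w') {g h : X → ℝ} {v : Y → ℝ} (hg : IsIndicator g) (hh : IsIndicator h) (hgm : Monotone g)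
    (hv : IsIndicator v) (hvm : Monotone v) :
    KahnPair (prodW w w') (liftX g * liftY v) (bor h v) :=
  kahnPair_of_le (isProbWeight_prodW hw hw') (isHarris_prodW hw hw' hX hY)
    ((isIndicator_liftX hg).mul (isIndicator_liftY hv)) (isIndicator_bor hh hv)
    ((monotone_liftX hgm).mul (monotone_liftY hvm) (fun z => hg.nonneg z.1) fun z => hv.nonneg z.2)
    (liftX_mul_liftY_le_bor hg hh hv)

/-! ## `B ∨ V` against `C`: `kahnPair_or_left` -/

omit [Preorder X] [Preorder Y] in
/-- `E(F · bor g v · h̃) = E_Y( v·H + (1−v)·D )` (`H(y) = E_X(F_y h)`, `D(y) = E_X(F_y g h)`), `v` an indicator. [this work] -/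
theorem ex_F_bor_h (w : X → ℝ) (w' : Y → ℝ) (F : X × Y → ℝ) (g h : X → ℝ) (v : Y → ℝ) :
    ex (prodW w w') (F * bor g v * liftX h) =
      ex w' (fun y => v y * ex w ((fun x => F (x, y)) * h) + (1 - v y) * ex w ((fun x => F (x, y)) * g * h)) := by
  rw [ex_prodW]; refine congrArg _ (funext fun y => ?_)
  unfold ex; rw [mul_sum, mul_sum, ← sum_add_distrib]
  exact sum_congr rfl fun x _ => by simp only [Pi.mul_apply, liftX, bor]; ring

omit [Preorder X] [Preorder Y] in
/-- `E(F · bor g v) = E_Y( v·a + (1−v)·G )`. [this work] -/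
theorem ex_F_bor (w : X → ℝ) (w' : Y → ℝ) (F : X × Y → ℝ) (g : X → ℝ) (v : Y → ℝ) :
    ex (prodW w w') (F * bor g v) =
      ex w' (fun y => v y * ex w (fun x => F (x, y)) + (1 - v y) * ex w ((fun x => F (x, y)) * g)) := by
  rw [ex_prodW]; refine congrArg _ (funext fun y => ?_)
  unfold ex; rw [mul_sum, mul_sum, ← sum_add_distrib]
  exact sum_congr rfl fun x _ => by simp only [Pi.mul_apply, bor]; ring

omit [Preorder X] [Preorder Y] in
/-- `E(bor g v) = v̄ + (1−v̄)·b` (probability weights). [this work] -/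
theorem ex_bor (w : X → ℝ) (w' : Y → ℝ) (hw : IsProbWeight w) (hw' : IsProbWeight w') (g : X → ℝ) (v : Y → ℝ) :
    ex (prodW w w') (bor g v) = ex w' v + (1 - ex w' v) * ex w g := by
  rw [ex_prodW]
  have : (fun y => ex w fun x => bor g v (x, y)) = (fun y => (1 - ex w g) * v y) + fun _ => ex w g := by
    funext y; simp only [Pi.add_apply]
    have e : (fun x => bor g v (x, y)) = (fun x => (1 - v y) * g x) + fun _ => v y := by
      funext x; simp only [bor, Pi.add_apply]; ring
    rw [e, ex_add, ex_smul, ex_const hw]; ring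
  rw [this, ex_add, ex_smul, ex_const hw']; ring

omit [Preorder X] [Preorder Y] in
/-- `E(bor g v · h̃) = v̄·c + (1−v̄)·E_X(g h)` (probability weights). [this work] -/
theorem ex_bor_h (w : X → ℝ) (w' : Y → ℝ) (hw' : IsProbWeight w') (g h : X → ℝ) (v : Y → ℝ) :
    ex (prodW w w') (bor g v * liftX h) = ex w' v * ex w h + (1 - ex w' v) * ex w (g * h) := by
  rw [ex_prodW]
  have : (fun y => ex w fun x => (bor g v * liftX h : X × Y → ℝ) (x, y)) =
      (fun y => (ex w h - ex w (g * h)) * v y) + fun _ => ex w (g * h) := by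
    funext y; simp only [Pi.add_apply]
    have e : (fun x => (bor g v * liftX h : X × Y → ℝ) (x, y)) = (fun x => v y * h x) + fun x => (1 - v y) * (g * h) x := by
      funext x; simp only [bor, liftX, Pi.add_apply, Pi.mul_apply]; ring
    rw [e, ex_add, ex_smul, ex_smul]; ring
  rw [this, ex_add, ex_smul, ex_const hw']; ring

omit [Fintype X] [Preorder X] [Preorder Y] in
/-- Linearity bookkeeping for `kahnPair_or_left`: the functional in fibre form. [this work] -/
theorem ex_lin_or_left (w' : Y → ℝ) (v D G H a : Y → ℝ) (c bs ks : ℝ) :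
    2 * ex w' (fun y => v y * H y + (1 - v y) * D y) - ex w' (fun y => v y * a y + (1 - v y) * G y) * c
        - ex w' H * bs - ks * ex w' a =
      ex w' (fun y => v y * ((2 - bs) * H y - (c + ks) * a y) + (1 - v y) * (2 * D y - c * G y - bs * H y - ks * a y)) := by
  simp only [ex, mul_sum, sum_mul, ← sum_sub_distrib]
  exact sum_congr rfl fun y _ => by ring

omit [Fintype X] [Preorder X] [Preorder Y] in
/-- Linearity bookkeeping: `E_Y(v·(1−v̄)·T − (1−v)·v̄·T) = E_Y(T·(v − v̄))`. [this work] -/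
theorem ex_lin_cov (w' : Y → ℝ) (v T : Y → ℝ) (vb : ℝ) :
    ex w' (fun y => v y * ((1 - vb) * T y) - (1 - v y) * (vb * T y)) = ex w' (fun y => T y * (v y - vb)) := by
  simp only [ex]; exact sum_congr rfl fun y _ => by ring

omit [Fintype Y] in
/-- For `F` monotone on `X × Y` and a fixed `φ ≥ 0` on `X`, `y ↦ E_X(F_y φ)` is monotone. [this work] -/
theorem monotone_ex_fibre_mul {w : X → ℝ} (hw : ∀ x, 0 ≤ w x) {F : X × Y → ℝ} (hF : Monotone F) {φ : X → ℝ}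
    (hφ : ∀ x, 0 ≤ φ x) : Monotone fun y => ex w (fun x => F (x, y) * φ x) :=
  fun _ _ hab => ex_mono hw fun x => mul_le_mul_of_nonneg_right (monotone_fibre_right hF x hab) (hφ x)

/-- **Module extension `(B,C) ↦ (B ∨ V, C)`.**  If `(g,h)` is a Kahn pair on the Harris space `X` and `v` a monotone
indicator on the Harris space `Y`, then `(bor g v, h̃)` is a Kahn pair on `X × Y`.  Proof: with `Θ₀(y) = E_X(F_y·h(1−g))`
(monotone in `y`), the fibre identities give `Φ_on ≥ (1−v̄)Θ₀` on `V` (Harris on `X` twice) and `Φ_off ≥ −v̄Θ₀` off `V`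
(fibre Kahn + conditional Harris), whence `E₃ ≥ E_Y(Θ₀·(v − v̄)) ≥ 0` (Harris on `Y`).  The transfer `θ = v̄(1−v̄)h(1−g)`
is the lineage's cell-transfer certificate (gen 54/55) for the degenerate section pattern `(B, ⊤)`. [this work] -/
theorem kahnPair_or_left {w : X → ℝ} {w' : Y → ℝ} (hw : IsProbWeight w) (hw' : IsProbWeight w') (hX : IsHarris w)
    (hY : IsHarris w') {g h : X → ℝ} {v : Y → ℝ} (hg : IsIndicator g) (hh : IsIndicator h) (hgm : Monotone g)
    (hhm : Monotone h) (hv : IsIndicator v) (hvm : Monotone v) (hK : KahnPair w g h) :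
    KahnPair (prodW w w') (bor g v) (liftX h) := by
  intro F hF hF0
  set a : Y → ℝ := fun y => ex w (fun x => F (x, y)) with ha
  set D : Y → ℝ := fun y => ex w ((fun x => F (x, y)) * g * h) with hD
  set G : Y → ℝ := fun y => ex w ((fun x => F (x, y)) * g) with hG
  set H : Y → ℝ := fun y => ex w ((fun x => F (x, y)) * h) with hH
  set vb : ℝ := ex w' v with hvb'
  set b : ℝ := ex w g
  set c : ℝ := ex w h
  set d : ℝ := ex w (g * h)
  have hb := ex_indicator_mem hw hg
  have hvb := ex_indicator_mem hw' hv
  have e1 := ex_F_bor_h w w' F g h v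
  have e2 := ex_F_bor w w' F g v
  have e3 := ex_F_g w w' F h
  have e4 := ex_bor w w' hw hw' g v
  have e5 := ex_bor_h w w' hw' g h v
  have e6 := ex_liftX w w' h hw'
  have e7 : ex (prodW w w') F = ex w' a := ex_prodW _ _ _
  -- Θ₀(y) = E_X(F_y · h · (1 − g)) = H y − D y, monotone in y
  have hΘ : (fun y => ex w (fun x => F (x, y) * (h x * (1 - g x)))) = fun y => H y - D y := by
    funext y; simp only [hH, hD, ← ex_sub]; refine congrArg _ (funext fun x => ?_); simp only [Pi.mul_apply, Pi.sub_apply]; ring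
  have Θm : Monotone fun y => H y - D y := by
    rw [← hΘ]; exact monotone_ex_fibre_mul hw.nonneg hF fun x => mul_nonneg (hh.nonneg x) (sub_nonneg.2 (hg.le_one x))
  have cov := hY.ex_mul_sub_nonneg Θm hvm
  -- fibre inequalities
  have on_ge : ∀ y, (2 - (vb + (1 - vb) * b)) * H y - (c + (1 - vb) * (d - b * c)) * a y ≥ (1 - vb) * (H y - D y) := by
    intro y
    have iH : c * a y ≤ H y := by
      have := hX _ h (monotone_fibre_left hF y) hhm; simp only [hH, ha]; linarith
    have iD : d * a y ≤ D y := by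
      have := hX _ (g * h) (monotone_fibre_left hF y) (hgm.mul hhm hg.nonneg hh.nonneg)
      simp only [hD, ha, ← mul_assoc] at this ⊢; linarith
    nlinarith [mul_nonneg (by nlinarith [hb.2, hvb.1, hvb.2] : (0:ℝ) ≤ 1 - (1 - vb) * b) (sub_nonneg.2 iH),
      mul_nonneg (sub_nonneg.2 hvb.2) (sub_nonneg.2 iD)]
  have off_ge : ∀ y, 2 * D y - c * G y - (vb + (1 - vb) * b) * H y - (1 - vb) * (d - b * c) * a y ≥ -(vb * (H y - D y)) := by
    intro y
    have ihy : 0 ≤ 2 * D y - G y * c - H y * b - d * a y + a y * b * c := by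
      have := hK _ (monotone_fibre_left hF y) fun x => hF0 (x, y); unfold kahnK at this
      simpa only [hD, hG, hH, ha] using this
    have iDG : c * G y ≤ D y := by
      have := hX ((fun x => F (x, y)) * g) h ((monotone_fibre_left hF y).mul hgm (fun x => hF0 (x, y)) hg.nonneg) hhm
      simp only [hD, hG]; linarith
    nlinarith [mul_nonneg (sub_nonneg.2 hvb.2) ihy, mul_nonneg hvb.1 (sub_nonneg.2 iDG)]
  -- assemble
  have key : kahnK (prodW w w') F (bor g v) (liftX h) =
      ex w' (fun y => v y * ((2 - (vb + (1 - vb) * b)) * H y - (c + (1 - vb) * (d - b * c)) * a y)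
        + (1 - v y) * (2 * D y - c * G y - (vb + (1 - vb) * b) * H y - (1 - vb) * (d - b * c) * a y)) := by
    unfold kahnK; rw [e1, e2, e3, e4, e5, e6, e7, ← ex_lin_or_left]; ring
  rw [key]
  calc (0:ℝ) ≤ ex w' (fun y => (H y - D y) * (v y - vb)) := cov
    _ = ex w' (fun y => v y * ((1 - vb) * (H y - D y)) - (1 - v y) * (vb * (H y - D y))) := (ex_lin_cov w' v _ vb).symm
    _ ≤ _ := ex_mono hw'.nonneg fun y => by
        nlinarith [mul_le_mul_of_nonneg_left (on_ge y) (hv.nonneg y),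
          mul_le_mul_of_nonneg_left (off_ge y) (sub_nonneg.2 (hv.le_one y))]

end Summit.CriticalPhenomena.PercolationContinuityZ3.Theorems.SahiKahnModule
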